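/-
Copyright (c) 2026 the pub-hodgecm-mathlib formalisation cell (harness21).  Prover seat hodgecm-mathlib-K2E3-p33 (g0), HCML Track B «K2-LIT»
(build stream 29), h413 = `stmt-HodgeConjecture-24833`, line `K2_E3_EllipticInputs`, unit U12 «Characters», CLOSE-OUT strike line L4 `stub_StCharTS`, letter (SC-an)₂
(PART «SC» :98) — the `N = 2` twin of ★ (M5e-2) `K2E3SplitTorusDepthFromDiscriminant` (K2E3-p14 (g3)): «THE DEPTH OF A REGULAR DIAGONAL ELEMENT OF `U(1,1)` FROM ITS
DISCRIMINANT» (LINE-LEAD K2E3-plan (g4) L4 EMIT #1∕#3 2026-09-04T14:52Z∕15:02Z; this seat's R0∕MAP lines `K2/STATUS.md` 15:02Z∕15:14Z).  2026-09-04.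
-/
import Summits.HodgeConjecture.HodgeConjecture.Theorems.K2E3SplitTorusDepthFromDiscriminant   -- ★ (M5e-2) p856891 (K2E3-p14 g3): the `Fin 3` template; its RANK-FREE §2∕§3 lemmas `v_pow_mul_sub_le_one`, `v_pow_le_v_of_v_pow_le_v_sq`, `pow_normAbs_le_normAbs_of_v_pow_mul_inv_le_one` are CITED, not restated; brings ★ `discr_prod_X_sub_C_eq_prod_prod_Ioi_sq`, ★ `normAbs`∕`normAbs_le_normAbs_iff`, ★ `v_le_iff_valuation_le`, ★ `glDiagonal`∕`coe_glDiagonal`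
import HarnessLib

/-!
# K2_E3 road (h413), letter (SC-an)₂, the `N = 2` twin of END-GAME MAP v2 piece (M5e-2): THE DEPTH OF A REGULAR DIAGONAL ELEMENT OF `U(1,1)` FROM ITS DISCRIMINANT —
# `disc χ_{diag(d₀,d₁)} = (d₁−d₀)²`, `det = d₀d₁`; `|ϖ^μ| ≤ |disc| ⇒ |ϖ^μ| ≤ |d₁ − d₀|` (NO height-ball loss at `2 × 2`), and on the height ball `Ω_m`:
# `‖ϖ‖^τ ≤ T(t) = √√(‖disc χ_t‖·‖det t‖⁻²) ⇒ |ϖ^{4τ+4m}| ≤ |dᵢ − dₖ|` (WeightKit₂ token), `‖ϖ‖^τ ≤ T♭(t) = √√(‖disc χ_t‖·‖det t‖⁻¹) ⇒ |ϖ^{4τ+2m}| ≤ |dᵢ − dₖ|` (HCD₂ token)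
# (Harish-Chandra 1970, Part VII §2 p. 69 (`q^{λ(x)} = |D(x)|`), §3 p. 71; Rogawski 1990, §3.1 p. 19, §4.9 p. 54)

Cell `pub/hodgecm-mathlib`, Track B «K2-LIT», crux H413 = `stmt-HodgeConjecture-24833` (`--supports … --as helper`, count-neutral).  THEOREMS ONLY (no `def`, no
`instance`, no `notation`, no named-fact hypothesis, no `sorry`).  PORT RECIPE (LINE-LEAD K2E3-plan (g4), L4 EMIT #1): new file `<Template>Two.lean`, namespace
`…Cruxes.H413.<Template>Two`, heads = the template's heads with suffix-free names (different namespace ⇒ no dedup clash); rank-free lemmas of the template are cited BY NAME.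

WHY.  The (M5h)₂ payer (the `N = 2` twin of ★ (M5h‴) `K2E3SupercuspidalTruncatedCharAnalyticOfEllWeightPlace`, whose line :242 reads
`K2E3SplitTorusDepthFromDiscriminant.v_pow_le_v_sub_of_pow_normAbs_le_token hϖ hdm hdm' hτ' hik`) and the (M5e-1)₂ split-shell assembly need, on the shell
`T(t) ≥ ‖ϖ‖^τ` of the height ball `Ω_m` of `U(σ, Φ₂)(K)`, the DEPTH `λ(t)` of a regular diagonal `t = diag(d₀, d₁)` — «`∀ i ≠ k, v(ϖ^λ) ≤ v(dᵢ − dₖ)`» — bounded LINEARLY in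
`τ` and `m`.  At `2 × 2` the characteristic polynomial has exactly one root difference, so the `Fin 3` bookkeeping (two spectator differences, each `≤ q^m`, costing `+4m`) disappears:
* §1 ALGEBRA: `charpoly_discr_diagonal_fin_two` — `disc χ_{diag d} = (d₁−d₀)²` (★ `discr_prod_X_sub_C_eq_prod_prod_Ioi_sq` ∘ Mathlib `Matrix.charpoly_diagonal`); `det (diag d) = d₀d₁`.
* §2 VALUATIONS (`Valued K ℤᵐ⁰`): **`v_pow_le_v_sub_sq_of_v_pow_le_v_discr`** (`|ϖ^μ| ≤ |(d₁−d₀)²| ⇒ |ϖ^μ| ≤ |(dᵢ−dₖ)²|` for `i ≠ k` — both ordered pairs), **`v_pow_le_v_sub_of_v_pow_le_v_discr`**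
  (`⇒ |ϖ^μ| ≤ |dᵢ − dₖ|`, via the template's ★ `v_pow_le_v_of_v_pow_le_v_sq`).  NO `Ω_m` hypothesis is needed here (contrast `μ + 4m` at `N = 3`).
* §3 THE TOKENS (`K` a non-archimedean local field with compatible `Valued`∕`ValuativeRel`): with `t = diag d ∈ Ω_m` read as `|ϖ^m dᵢ⁻¹| ≤ 1` (so `‖det t‖ = ‖d₀d₁‖ ≥ ‖ϖ‖^{2m}`, ★
  `pow_normAbs_le_normAbs_of_v_pow_mul_inv_le_one`):
  - WeightKit₂ token `T(t) = √√(‖disc χ_t‖ · ‖det t‖⁻²)` (★ p861141 `K2E3SupercuspidalTruncatedCharWeightKitTwo.continuous_token`, det-exponent `2` kept from `N = 3`):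
    **`v_pow_le_v_discr_of_pow_normAbs_le_token`** (`‖ϖ‖^τ ≤ T(t) ⇒ |ϖ^{4τ+4m}| ≤ |disc χ_t|`) and the consumer form **`v_pow_le_v_sub_of_pow_normAbs_le_token`**
    (`‖ϖ‖^τ ≤ T(t) ⇒ ∀ i ≠ k, v(ϖ^{4τ+4m}) ≤ v(dᵢ − dₖ)`, `|ϖ| = exp(−1)`) — the depth `λ(t) ≤ 4τ + 4m` (the payer's `N = 3` line ports with `10 * m ↦ 4 * m` and the `hdm` argument dropped);
  - HCD₂ token `T♭(t) = √√(‖disc χ_t‖ · ‖det t‖⁻¹)` (the Weyl discriminant `|D_{U(1,1)}(t)|^{1∕2} = (|ξ₁ − ξ₂|²∕|ξ₁ξ₂|)^{1∕2}` of ★ `K2E3U11WeylDiscrLocInt` :75, det-exponent `1`):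
    **`v_pow_le_v_discr_of_pow_normAbs_le_weylToken`** (`⇒ |ϖ^{4τ+2m}| ≤ |disc χ_t|`) and **`v_pow_le_v_sub_of_pow_normAbs_le_weylToken`** (`⇒ ∀ i ≠ k, v(ϖ^{4τ+2m}) ≤ v(dᵢ − dₖ)`).
  On the unitary group at a non-split place `‖det t‖ = 1`, so the two tokens agree there; both shapes are offered so that either consumer docks BY NAME without a rewrite.

HONEST LABEL: HC_CM is proved only modulo the 7 printed citations (2 remaining named inputs: hLiu418 = `stmt-HodgeConjecture-24832`, h413 =
`stmt-HodgeConjecture-24833`) until rung 0 closes; this file is a count-neutral helper (valuation bookkeeping; nothing printed is asserted as a fact).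

## References
* [HarishChandra1970] Harish-Chandra (notes by G. van Dijk), *Harmonic Analysis on Reductive p-adic Groups*, LNM 162 (1970), Part VII §2 p. 69 (`q^{λ(x)} = |D(x)|`, Cor. of
  Thm 18), §3 pp. 71–72 (`Ω(γ)`, `(1+|λ(γ)|)^{4ℓ}`).
* [Rogawski1990] J. D. Rogawski, *Automorphic Representations of Unitary Groups in Three Variables*, Ann. of Math. Stud. 123 (1990), §3.1 p. 19 (regular elements, `D_G`),
  §4.9 p. 54 (the Weyl integration formula for `U(1,1)` and `U(2,1)`).
-/

set_option autoImplicit false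
-- the mandated namespace repeats the single-problem summit's segment (`HodgeConjecture.HodgeConjecture`)
set_option linter.dupNamespace false

noncomputable section

open Polynomial Finset
open scoped NNReal MatrixGroups WithZero
open Literature.NumberTheory.Automorphic Literature.NumberTheory.GaloisRepresentations Literature.NumberTheory.GaloisRepresentations.IsNonarchimedeanLocalField

namespace Summit.HodgeConjecture.HodgeConjecture.Cruxes.H413.K2E3SplitTorusDepthFromDiscriminantTwo

/-! ## §1 Algebra: the discriminant and the determinant of a diagonal `2 × 2` matrix -/

section Algebra

variable {K : Type*} [Field K]

/-- `∏_{i<j} (dⱼ − dᵢ)²` on `Fin 2` is the single factor `(d₁ − d₀)²`. [cite: Rogawski1990, §3.1 p. 19] -/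
theorem prod_prod_Ioi_sub_sq_fin_two (d : Fin 2 → K) :
    ∏ i : Fin 2, ∏ j ∈ Ioi i, (d j - d i) ^ 2 = (d 1 - d 0) ^ 2 := by
  rw [Fin.prod_univ_two]
  have h0 : Ioi (0 : Fin 2) = {1} := by decide
  have h1 : Ioi (1 : Fin 2) = ∅ := by decide
  rw [h0, h1, prod_singleton, prod_empty, mul_one]

/-- **`disc χ_{diag(d₀,d₁)} = (d₁−d₀)²`** (`χ_{diag d} = ∏ (X − dᵢ)`, Mathlib `Matrix.charpoly_diagonal`; ★ `discr_prod_X_sub_C_eq_prod_prod_Ioi_sq`).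
[cite: Rogawski1990, §3.1 p. 19] -/
theorem charpoly_discr_diagonal_fin_two (d : Fin 2 → K) :
    (Matrix.diagonal d).charpoly.discr = (d 1 - d 0) ^ 2 := by
  rw [Matrix.charpoly_diagonal, Literature.Algebra.Polynomial.DiscriminantRootProduct.discr_prod_X_sub_C_eq_prod_prod_Ioi_sq,
    prod_prod_Ioi_sub_sq_fin_two]

/-- The same for the torus element `glDiagonal 2 K d ∈ GL₂(K)` (★ `coe_glDiagonal`). [cite: Rogawski1990, §3.1 p. 19] -/
theorem charpoly_discr_coe_glDiagonal (d : Fin 2 → Kˣ) :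
    ((glDiagonal 2 K d : GL (Fin 2) K) : Matrix (Fin 2) (Fin 2) K).charpoly.discr = (((d 1 : K) - d 0)) ^ 2 := by
  rw [coe_glDiagonal, charpoly_discr_diagonal_fin_two]

/-- `det (glDiagonal 2 K d) = d₀ d₁`. [cite: Rogawski1990, §3.1 p. 19] -/
theorem det_coe_glDiagonal (d : Fin 2 → Kˣ) :
    ((glDiagonal 2 K d : GL (Fin 2) K) : Matrix (Fin 2) (Fin 2) K).det = (d 0 : K) * d 1 := by
  rw [coe_glDiagonal, Matrix.det_diagonal, Fin.prod_univ_two]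

end Algebra

/-! ## §2 Valuations: depth of the root difference from the depth of the discriminant (no height-ball loss at `2 × 2`) -/

section Valued

variable {K : Type*} [Field K] [Valued K ℤᵐ⁰]

/-- **DEPTH OF THE ROOT DIFFERENCE FROM THE DEPTH OF THE DISCRIMINANT, SQUARED FORM**: `|ϖ^μ| ≤ |(d₁−d₀)²| ⇒ |ϖ^μ| ≤ |(dᵢ − dₖ)²|` for every `i ≠ k` in `Fin 2`
(both ordered pairs: `(d₀−d₁)² = (d₁−d₀)²`).  At `2 × 2` there are no spectator root differences, hence no `Ω_m` hypothesis and no `+4m`.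
[cite: HarishChandra1970, Part VII §3 p. 71] [cite: Rogawski1990, §3.1 p. 19] -/
theorem v_pow_le_v_sub_sq_of_v_pow_le_v_discr {ϖ : K} {d : Fin 2 → K} {μ : ℕ}
    (hΔ : Valued.v (ϖ ^ μ) ≤ Valued.v ((d 1 - d 0) ^ 2)) {i k : Fin 2} (hik : i ≠ k) :
    Valued.v (ϖ ^ μ) ≤ Valued.v ((d i - d k) ^ 2) := by
  fin_cases i <;> fin_cases k
  · exact absurd rfl hik
  · show Valued.v (ϖ ^ μ) ≤ Valued.v ((d 0 - d 1) ^ 2)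
    rwa [show (d 0 - d 1) ^ 2 = (d 1 - d 0) ^ 2 by ring]
  · exact hΔ
  · exact absurd rfl hik

/-- **DEPTH OF THE ROOT DIFFERENCE FROM THE DEPTH OF THE DISCRIMINANT**: `|ϖ| ≤ 1`, `|ϖ^μ| ≤ |(d₁−d₀)²| ⇒ ∀ i ≠ k, |ϖ^μ| ≤ |dᵢ − dₖ|` — the DEPTH `λ(t) ≤ μ` in the line's
convention «`∀ i ≠ k, v(ϖ^λ) ≤ v(dᵢ − dₖ)`» (the template's ★ `v_pow_le_v_of_v_pow_le_v_sq`: if `|x| ≥ 1` trivially, else `|x|² ≤ |x|`).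
[cite: HarishChandra1970, Part VII §3 p. 71] [cite: Rogawski1990, §3.1 p. 19] -/
theorem v_pow_le_v_sub_of_v_pow_le_v_discr {ϖ : K} (hϖ1 : Valued.v ϖ ≤ 1) {d : Fin 2 → K} {μ : ℕ}
    (hΔ : Valued.v (ϖ ^ μ) ≤ Valued.v ((d 1 - d 0) ^ 2)) {i k : Fin 2} (hik : i ≠ k) :
    Valued.v (ϖ ^ μ) ≤ Valued.v (d i - d k) :=
  K2E3SplitTorusDepthFromDiscriminant.v_pow_le_v_of_v_pow_le_v_sq hϖ1 (v_pow_le_v_sub_sq_of_v_pow_le_v_discr hΔ hik)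

end Valued

/-! ## §3 The discriminant tokens of `U(1,1)`: `T(t) = √√(‖disc χ_t‖·‖det t‖⁻²)` (WeightKit₂) and `T♭(t) = √√(‖disc χ_t‖·‖det t‖⁻¹)` (HCD₂ Weyl discriminant) -/

section Token

variable {K : Type*} [Field K] [Valued K ℤᵐ⁰] [ValuativeRel K] [(Valued.v : Valuation K ℤᵐ⁰).Compatible] [IsNonarchimedeanLocalField K]

/-- On `Ω_m` the determinant of `t = diag(d₀, d₁)` is not too small: `|ϖ^m dᵢ⁻¹| ≤ 1 (i = 0, 1) ⇒ ‖ϖ‖^{2m} ≤ ‖det t‖ = ‖d₀‖‖d₁‖` (the template's ★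
`pow_normAbs_le_normAbs_of_v_pow_mul_inv_le_one`, twice). [cite: HarishChandra1970, Part VII §2 p. 69] -/
theorem pow_normAbs_le_normAbs_det_of_v_pow_mul_inv_le_one {ϖ : K} {d : Fin 2 → Kˣ} {m : ℕ} (hd' : ∀ i, Valued.v (ϖ ^ m * ((d i : K))⁻¹) ≤ 1) :
    normAbs K ϖ ^ (2 * m) ≤ normAbs K ((((glDiagonal 2 K d : GL (Fin 2) K) : Matrix (Fin 2) (Fin 2) K)).det) := by
  have h0 := K2E3SplitTorusDepthFromDiscriminant.pow_normAbs_le_normAbs_of_v_pow_mul_inv_le_one (d 0).ne_zero (hd' 0)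
  have h1 := K2E3SplitTorusDepthFromDiscriminant.pow_normAbs_le_normAbs_of_v_pow_mul_inv_le_one (d 1).ne_zero (hd' 1)
  rw [det_coe_glDiagonal, map_mul, show 2 * m = m + m by ring, pow_add]
  exact mul_le_mul' h0 h1

omit [(Valued.v : Valuation K ℤᵐ⁰).Compatible] in
/-- The determinant of `t = diag(d₀, d₁)`, `dᵢ ∈ Kˣ`, has positive normalised absolute value. [cite: Rogawski1990, §3.1 p. 19] -/
theorem normAbs_det_coe_glDiagonal_pos (d : Fin 2 → Kˣ) :
    0 < normAbs K ((((glDiagonal 2 K d : GL (Fin 2) K) : Matrix (Fin 2) (Fin 2) K)).det) :=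
  pos_iff_ne_zero.2 ((map_ne_zero (normAbs K)).2 (by rw [det_coe_glDiagonal]; exact mul_ne_zero (d 0).ne_zero (d 1).ne_zero))

/-- **THE DISCRIMINANT DEPTH FROM THE WeightKit₂ TOKEN**: for `t = diag d ∈ Ω_m` (`|ϖ^m dᵢ⁻¹| ≤ 1`) and `τ` with `‖ϖ‖^τ ≤ T(t) = √√(‖disc χ_t‖ · ‖det t‖⁻²)`:
`|ϖ^{4τ+4m}| ≤ |disc χ_t|` — since `‖disc χ_t‖ ≥ T⁴·‖det t‖²` and `‖det t‖ = ‖d₀d₁‖ ≥ ‖ϖ‖^{2m}`.  Token shape = ★ `K2E3SupercuspidalTruncatedCharWeightKitTwo.continuous_token` VERBATIM.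
[cite: HarishChandra1970, Part VII §2 p. 69] [cite: Rogawski1990, §3.1 p. 19] -/
theorem v_pow_le_v_discr_of_pow_normAbs_le_token {ϖ : K} {d : Fin 2 → Kˣ} {m : ℕ} (hd' : ∀ i, Valued.v (ϖ ^ m * ((d i : K))⁻¹) ≤ 1) {τ : ℕ}
    (hT : normAbs K ϖ ^ τ ≤ NNReal.sqrt (NNReal.sqrt
      (normAbs K ((((glDiagonal 2 K d : GL (Fin 2) K) : Matrix (Fin 2) (Fin 2) K)).charpoly.discr) *
        (normAbs K ((((glDiagonal 2 K d : GL (Fin 2) K) : Matrix (Fin 2) (Fin 2) K)).det) ^ 2)⁻¹))) :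
    Valued.v (ϖ ^ (4 * τ + 4 * m)) ≤ Valued.v ((((glDiagonal 2 K d : GL (Fin 2) K) : Matrix (Fin 2) (Fin 2) K)).charpoly.discr) := by
  set A := normAbs K ((((glDiagonal 2 K d : GL (Fin 2) K) : Matrix (Fin 2) (Fin 2) K)).charpoly.discr) with hA
  set B := normAbs K ((((glDiagonal 2 K d : GL (Fin 2) K) : Matrix (Fin 2) (Fin 2) K)).det) with hB
  set r := normAbs K ϖ with hr
  -- `‖det t‖ ≥ ‖ϖ‖^{2m} > 0`
  have hBge : r ^ (2 * m) ≤ B := pow_normAbs_le_normAbs_det_of_v_pow_mul_inv_le_one hd'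
  have hBpos : 0 < B := normAbs_det_coe_glDiagonal_pos d
  -- `‖ϖ‖^{4τ} ≤ A · (B²)⁻¹`, i.e. `‖ϖ‖^{4τ} · B² ≤ A`
  have h4 : r ^ (4 * τ) ≤ A * (B ^ 2)⁻¹ := by
    have h := hT
    rw [NNReal.le_sqrt_iff_sq_le, NNReal.le_sqrt_iff_sq_le] at h
    rwa [show (4 * τ) = τ * 2 * 2 by ring, pow_mul, pow_mul]
  have h5 : r ^ (4 * τ) * B ^ 2 ≤ A := (le_mul_inv_iff₀ (pow_pos hBpos 2)).1 h4
  -- `A ≥ ‖ϖ‖^{4τ+4m} = ‖ϖ^{4τ+4m}‖`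
  have h6 : normAbs K (ϖ ^ (4 * τ + 4 * m)) ≤ A := by
    have h7 : r ^ (4 * τ + 4 * m) = r ^ (4 * τ) * (r ^ (2 * m)) ^ 2 := by ring
    rw [map_pow, ← hr, h7]
    exact (mul_le_mul' le_rfl (pow_le_pow_left' hBge 2)).trans h5
  exact (v_le_iff_valuation_le _ _).2 (normAbs_le_normAbs_iff.1 h6)

/-- **THE DEPTH OF A REGULAR DIAGONAL ELEMENT OF `U(1,1)` FROM ITS WeightKit₂ TOKEN** (the consumer form for the (M5h)₂ payer and the (M5e-1)₂ shell assembly): for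
`t = diag d ∈ Ω_m` (`|ϖ^m dᵢ⁻¹| ≤ 1`), `|ϖ| = exp(−1)`, and `τ` with `‖ϖ‖^τ ≤ T(t)` (`T⁴ = ‖disc χ_t‖·‖det t‖⁻²`): `∀ i ≠ k, v(ϖ^{4τ+4m}) ≤ v(dᵢ − dₖ)` — the depth
`λ(t) ≤ 4τ + 4m`, so every bound POLYNOMIAL in `λ` on `Ω_m` is polynomial in `|log_q T(t)|`.  (The `N = 3` template gives `4τ + 10m` and also wants `|ϖ^m dᵢ| ≤ 1`; at `2 × 2`
that hypothesis is not needed.) [cite: HarishChandra1970, Part VII §2 p. 69; §3 pp. 71–72] [cite: Rogawski1990, §3.1 p. 19] -/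
theorem v_pow_le_v_sub_of_pow_normAbs_le_token {ϖ : K} (hϖ : Valued.v ϖ = WithZero.exp (-1 : ℤ)) {d : Fin 2 → Kˣ} {m : ℕ}
    (hd' : ∀ i, Valued.v (ϖ ^ m * ((d i : K))⁻¹) ≤ 1) {τ : ℕ}
    (hT : normAbs K ϖ ^ τ ≤ NNReal.sqrt (NNReal.sqrt
      (normAbs K ((((glDiagonal 2 K d : GL (Fin 2) K) : Matrix (Fin 2) (Fin 2) K)).charpoly.discr) *
        (normAbs K ((((glDiagonal 2 K d : GL (Fin 2) K) : Matrix (Fin 2) (Fin 2) K)).det) ^ 2)⁻¹)))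
    {i k : Fin 2} (hik : i ≠ k) : Valued.v (ϖ ^ (4 * τ + 4 * m)) ≤ Valued.v ((d i : K) - d k) := by
  have hϖ1 : Valued.v ϖ ≤ 1 := by
    rw [hϖ, ← WithZero.exp_zero, WithZero.exp_le_exp]; norm_num
  have hΔ := v_pow_le_v_discr_of_pow_normAbs_le_token hd' hT
  rw [charpoly_discr_coe_glDiagonal] at hΔ
  exact v_pow_le_v_sub_of_v_pow_le_v_discr hϖ1 (d := fun i => (d i : K)) hΔ hik

/-- **THE DISCRIMINANT DEPTH FROM THE HCD₂ WEYL TOKEN**: for `t = diag d ∈ Ω_m` (`|ϖ^m dᵢ⁻¹| ≤ 1`) and `τ` with `‖ϖ‖^τ ≤ T♭(t) = √√(‖disc χ_t‖ · ‖det t‖⁻¹)`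
(`T♭(t)² = |D_{U(1,1)}(t)| = |ξ₁ − ξ₂|²∕|ξ₁ξ₂|`, the one-place shape of ★ `K2E3U11WeylDiscrLocInt.token_localNonsplitEquiv_two_eq`): `|ϖ^{4τ+2m}| ≤ |disc χ_t|` — since
`‖disc χ_t‖ ≥ T♭⁴·‖det t‖` and `‖det t‖ ≥ ‖ϖ‖^{2m}`. [cite: HarishChandra1970, Part VII §2 p. 69] [cite: Rogawski1990, §4.9 p. 54] -/
theorem v_pow_le_v_discr_of_pow_normAbs_le_weylToken {ϖ : K} {d : Fin 2 → Kˣ} {m : ℕ} (hd' : ∀ i, Valued.v (ϖ ^ m * ((d i : K))⁻¹) ≤ 1) {τ : ℕ}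
    (hT : normAbs K ϖ ^ τ ≤ NNReal.sqrt (NNReal.sqrt
      (normAbs K ((((glDiagonal 2 K d : GL (Fin 2) K) : Matrix (Fin 2) (Fin 2) K)).charpoly.discr) *
        (normAbs K ((((glDiagonal 2 K d : GL (Fin 2) K) : Matrix (Fin 2) (Fin 2) K)).det))⁻¹))) :
    Valued.v (ϖ ^ (4 * τ + 2 * m)) ≤ Valued.v ((((glDiagonal 2 K d : GL (Fin 2) K) : Matrix (Fin 2) (Fin 2) K)).charpoly.discr) := by
  set A := normAbs K ((((glDiagonal 2 K d : GL (Fin 2) K) : Matrix (Fin 2) (Fin 2) K)).charpoly.discr) with hA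
  set B := normAbs K ((((glDiagonal 2 K d : GL (Fin 2) K) : Matrix (Fin 2) (Fin 2) K)).det) with hB
  set r := normAbs K ϖ with hr
  have hBge : r ^ (2 * m) ≤ B := pow_normAbs_le_normAbs_det_of_v_pow_mul_inv_le_one hd'
  have hBpos : 0 < B := normAbs_det_coe_glDiagonal_pos d
  -- `‖ϖ‖^{4τ} ≤ A · B⁻¹`, i.e. `‖ϖ‖^{4τ} · B ≤ A`
  have h4 : r ^ (4 * τ) ≤ A * B⁻¹ := by
    have h := hT
    rw [NNReal.le_sqrt_iff_sq_le, NNReal.le_sqrt_iff_sq_le] at h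
    rwa [show (4 * τ) = τ * 2 * 2 by ring, pow_mul, pow_mul]
  have h5 : r ^ (4 * τ) * B ≤ A := (le_mul_inv_iff₀ hBpos).1 h4
  -- `A ≥ ‖ϖ‖^{4τ+2m} = ‖ϖ^{4τ+2m}‖`
  have h6 : normAbs K (ϖ ^ (4 * τ + 2 * m)) ≤ A := by
    rw [map_pow, ← hr, pow_add]
    exact (mul_le_mul' le_rfl hBge).trans h5
  exact (v_le_iff_valuation_le _ _).2 (normAbs_le_normAbs_iff.1 h6)

/-- **THE DEPTH OF A REGULAR DIAGONAL ELEMENT OF `U(1,1)` FROM ITS HCD₂ WEYL TOKEN** (consumer form for the det-exponent-`1` token of ★ `K2E3U11WeylDiscrLocInt`): for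
`t = diag d ∈ Ω_m` (`|ϖ^m dᵢ⁻¹| ≤ 1`), `|ϖ| = exp(−1)`, and `τ` with `‖ϖ‖^τ ≤ T♭(t)`: `∀ i ≠ k, v(ϖ^{4τ+2m}) ≤ v(dᵢ − dₖ)` — the depth `λ(t) ≤ 4τ + 2m`.
[cite: HarishChandra1970, Part VII §2 p. 69; §3 pp. 71–72] [cite: Rogawski1990, §4.9 p. 54] -/
theorem v_pow_le_v_sub_of_pow_normAbs_le_weylToken {ϖ : K} (hϖ : Valued.v ϖ = WithZero.exp (-1 : ℤ)) {d : Fin 2 → Kˣ} {m : ℕ}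
    (hd' : ∀ i, Valued.v (ϖ ^ m * ((d i : K))⁻¹) ≤ 1) {τ : ℕ}
    (hT : normAbs K ϖ ^ τ ≤ NNReal.sqrt (NNReal.sqrt
      (normAbs K ((((glDiagonal 2 K d : GL (Fin 2) K) : Matrix (Fin 2) (Fin 2) K)).charpoly.discr) *
        (normAbs K ((((glDiagonal 2 K d : GL (Fin 2) K) : Matrix (Fin 2) (Fin 2) K)).det))⁻¹)))
    {i k : Fin 2} (hik : i ≠ k) : Valued.v (ϖ ^ (4 * τ + 2 * m)) ≤ Valued.v ((d i : K) - d k) := by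
  have hϖ1 : Valued.v ϖ ≤ 1 := by
    rw [hϖ, ← WithZero.exp_zero, WithZero.exp_le_exp]; norm_num
  have hΔ := v_pow_le_v_discr_of_pow_normAbs_le_weylToken hd' hT
  rw [charpoly_discr_coe_glDiagonal] at hΔ
  exact v_pow_le_v_sub_of_v_pow_le_v_discr hϖ1 (d := fun i => (d i : K)) hΔ hik

end Token

end Summit.HodgeConjecture.HodgeConjecture.Cruxes.H413.K2E3SplitTorusDepthFromDiscriminantTwo

end
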